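import Mathlib
import Summits.Ventures.PercRepro2.MixChordRoot

/-!
# Sure relabelling: `Gc` does not see which vertex of a weight-`1` cluster carries a mark
(blind cell PercRepro2, night-1 g19; proofs/NIGHT1-G19.md §7)

If `a₁ ↔ x` on the support of `p` (e.g. `x` in the weight-`1` cluster of `a₁`), every event of
`Gc` agrees on the support with the event in which `a₁` is replaced by `x`, so
**`Gc_relabel_a1`**: `Gc p ends o a₁ a₂ a₃ b = Gc p ends o x a₂ a₃ b`; likewise **`Gc_relabel_a3`**
for `a₃ ↔ x`.  Consequences: (MIX-CHORD) along every fractional edge between the weight-`1`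
cluster of `a₃` and the weight-`1` cluster of a root (**`mixChord_a3Cluster_rootCluster`**, from
g18's root-edge chord theorem through the relabelling — the `S₃`–`S_l` / `S₃`–`S_h` edges of the
`a₃`-route and the root edges of the `a₃`-coincidence class of the root-route), and the
root-edge-at-`a₁` statements of the cell transfer to any vertex of `S_l`.

Own code; standard axioms.
-/

namespace Summit.Ventures.PercRepro2

open UnionCluster CovForm

namespace Mix

section Congr

variable {V : Type*} {E : Type*} [Fintype E] [DecidableEq E] {R : Type*} [Field R]
  [LinearOrder R] [IsStrictOrderedRing R]

variable (p : E → R) {ends : E → Sym2 V}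

omit [LinearOrder R] [IsStrictOrderedRing R] in
/-- Events agreeing on the support of `p` have the same probability. -/
lemma prob_congr_support (A B : Set (Config E)) (h : ∀ ω, weight p ω ≠ 0 → (ω ∈ A ↔ ω ∈ B)) :
    prob p A = prob p B := by
  unfold prob
  refine Finset.sum_congr rfl fun ω _ => ?_
  by_cases hω : weight p ω = 0
  · have hz : ∀ S : Set (Config E), S.indicator (weight p) ω = 0 := fun S => by
      by_cases hS : ω ∈ S
      · rw [Set.indicator_of_mem hS, hω]
      · rw [Set.indicator_of_notMem hS]
    rw [hz, hz]
  · by_cases hA : ω ∈ A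
    · rw [Set.indicator_of_mem hA, Set.indicator_of_mem ((h ω hω).1 hA)]
    · rw [Set.indicator_of_notMem hA, Set.indicator_of_notMem (fun hB => hA ((h ω hω).2 hB))]

variable {a₁ a₂ a₃ x : V}

omit [DecidableEq E] [LinearOrder R] [IsStrictOrderedRing R] in
/-- On the support, `a₁ ↔ v ↔ x ↔ v` when `a₁ ↔ x`. -/
lemma conn_left_iff (hx : ∀ ω, weight p ω ≠ 0 → Conn ends ω a₁ x) (ω : Config E)
    (hω : weight p ω ≠ 0) (v : V) : Conn ends ω a₁ v ↔ Conn ends ω x v :=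
  ⟨fun h => conn_trans (conn_symm (hx ω hω)) h, fun h => conn_trans (hx ω hω) h⟩

omit [DecidableEq E] [LinearOrder R] [IsStrictOrderedRing R] in
/-- On the support, `v ↔ a₁ ↔ v ↔ x` when `a₁ ↔ x`. -/
lemma conn_left_iff' (hx : ∀ ω, weight p ω ≠ 0 → Conn ends ω a₁ x) (ω : Config E)
    (hω : weight p ω ≠ 0) (v : V) : Conn ends ω v a₁ ↔ Conn ends ω v x :=
  ⟨fun h => conn_trans h (hx ω hω), fun h => conn_trans h (conn_symm (hx ω hω))⟩

end Congr

section Relabel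

variable {V : Type*} {E : Type*} [Fintype E] [DecidableEq E] [DecidableEq V] {R : Type*}
  [Field R] [LinearOrder R] [IsStrictOrderedRing R]

variable (p : E → R) (ends : E → Sym2 V) (o : V) {a₁ a₂ a₃ x : V} (b : V)

omit [DecidableEq V] in
/-- **Relabelling the root `a₁`**: if `a₁ ↔ x` on the support, `Gc` is unchanged when `a₁` is
replaced by `x`. -/
theorem Gc_relabel_a1 (hx : ∀ ω, weight p ω ≠ 0 → Conn ends ω a₁ x) :
    Gc p ends o a₁ a₂ a₃ b = Gc p ends o x a₂ a₃ b := by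
  have h1 := conn_left_iff p hx
  have h1' := conn_left_iff' p hx
  have hQ : ∀ ω, weight p ω ≠ 0 → (ω ∈ avoidAll ends a₂ {a₁} ↔ ω ∈ avoidAll ends a₂ {x}) :=
    fun ω hω => by simp only [mem_avoidAll, Finset.mem_singleton, forall_eq, h1' ω hω]
  have hPD : ∀ ω, weight p ω ≠ 0 → (ω ∈ PDEvent ends a₁ a₂ a₃ ↔ ω ∈ PDEvent ends x a₂ a₃) :=
    fun ω hω => by
      simp only [PDEvent, Dtilde, UnionCluster.inU, Set.mem_inter_iff, Set.mem_compl_iff,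
        Set.mem_union, mem_connEvent, h1 ω hω, h1' ω hω]
  have hT : ∀ ω, weight p ω ≠ 0 → (ω ∈ TEvent ends a₁ a₂ a₃ ↔ ω ∈ TEvent ends x a₂ a₃) :=
    fun ω hω => by
      simp only [TEvent, Set.mem_inter_iff, Set.mem_compl_iff, mem_connEvent, h1' ω hω]
  have hT' : ∀ ω, weight p ω ≠ 0 → (ω ∈ TEvent ends a₂ a₁ a₃ ↔ ω ∈ TEvent ends a₂ x a₃) :=
    fun ω hω => by
      simp only [TEvent, Set.mem_inter_iff, Set.mem_compl_iff, mem_connEvent, h1 ω hω]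
  have hc1 : ∀ v ω, weight p ω ≠ 0 → (ω ∈ connEvent ends a₁ v ↔ ω ∈ connEvent ends x v) :=
    fun v ω hω => by simp only [mem_connEvent, h1 ω hω]
  unfold Gc DEF EQbo EQb3 EQb3o EQo EQ3 EQ3o PDb PDbo Do
  rw [gap_eq_Q, gap_eq_Q]
  rw [
    prob_congr_support p (avoidAll ends a₂ {a₁})
      (avoidAll ends a₂ {x}) (fun ω hω => (hQ ω hω)),
    prob_congr_support p (avoidAll ends a₂ {a₁} ∩ (connEvent ends a₁ o ∩ connEvent ends a₁ b))
      (avoidAll ends a₂ {x} ∩ (connEvent ends x o ∩ connEvent ends x b)) (fun ω hω => ((hQ ω hω).and ((hc1 o ω hω).and (hc1 b ω hω)))),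
    prob_congr_support p (avoidAll ends a₂ {a₁} ∩ (connEvent ends a₂ o ∩ connEvent ends a₂ b))
      (avoidAll ends a₂ {x} ∩ (connEvent ends a₂ o ∩ connEvent ends a₂ b)) (fun ω hω => ((hQ ω hω).and (Iff.rfl.and Iff.rfl))),
    prob_congr_support p (avoidAll ends a₂ {a₁} ∩ (connEvent ends a₂ o ∩ connEvent ends a₁ b))
      (avoidAll ends a₂ {x} ∩ (connEvent ends a₂ o ∩ connEvent ends x b)) (fun ω hω => ((hQ ω hω).and (Iff.rfl.and (hc1 b ω hω)))),
    prob_congr_support p (avoidAll ends a₂ {a₁} ∩ (connEvent ends a₁ o ∩ connEvent ends a₂ b))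
      (avoidAll ends a₂ {x} ∩ (connEvent ends x o ∩ connEvent ends a₂ b)) (fun ω hω => ((hQ ω hω).and ((hc1 o ω hω).and Iff.rfl))),
    prob_congr_support p (avoidAll ends a₂ {a₁} ∩ connEvent ends a₁ o)
      (avoidAll ends a₂ {x} ∩ connEvent ends x o) (fun ω hω => ((hQ ω hω).and (hc1 o ω hω))),
    prob_congr_support p (avoidAll ends a₂ {a₁} ∩ connEvent ends a₂ o)
      (avoidAll ends a₂ {x} ∩ connEvent ends a₂ o) (fun ω hω => ((hQ ω hω).and Iff.rfl)),
    prob_congr_support p (avoidAll ends a₂ {a₁} ∩ connEvent ends a₂ b)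
      (avoidAll ends a₂ {x} ∩ connEvent ends a₂ b) (fun ω hω => ((hQ ω hω).and Iff.rfl)),
    prob_congr_support p (avoidAll ends a₂ {a₁} ∩ connEvent ends a₁ b)
      (avoidAll ends a₂ {x} ∩ connEvent ends x b) (fun ω hω => ((hQ ω hω).and (hc1 b ω hω))),
    prob_congr_support p (PDEvent ends a₁ a₂ a₃)
      (PDEvent ends x a₂ a₃) (fun ω hω => (hPD ω hω)),
    prob_congr_support p (PDEvent ends a₁ a₂ a₃ ∩ connEvent ends a₁ b)
      (PDEvent ends x a₂ a₃ ∩ connEvent ends x b) (fun ω hω => ((hPD ω hω).and (hc1 b ω hω))),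
    prob_congr_support p (PDEvent ends a₁ a₂ a₃ ∩ connEvent ends a₂ b)
      (PDEvent ends x a₂ a₃ ∩ connEvent ends a₂ b) (fun ω hω => ((hPD ω hω).and Iff.rfl)),
    prob_congr_support p (PDEvent ends a₁ a₂ a₃ ∩ (connEvent ends a₁ o ∩ connEvent ends a₁ b))
      (PDEvent ends x a₂ a₃ ∩ (connEvent ends x o ∩ connEvent ends x b)) (fun ω hω => ((hPD ω hω).and ((hc1 o ω hω).and (hc1 b ω hω)))),
    prob_congr_support p (PDEvent ends a₁ a₂ a₃ ∩ (connEvent ends a₂ o ∩ connEvent ends a₁ b))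
      (PDEvent ends x a₂ a₃ ∩ (connEvent ends a₂ o ∩ connEvent ends x b)) (fun ω hω => ((hPD ω hω).and (Iff.rfl.and (hc1 b ω hω)))),
    prob_congr_support p (PDEvent ends a₁ a₂ a₃ ∩ (connEvent ends a₁ o ∩ connEvent ends a₂ b))
      (PDEvent ends x a₂ a₃ ∩ (connEvent ends x o ∩ connEvent ends a₂ b)) (fun ω hω => ((hPD ω hω).and ((hc1 o ω hω).and Iff.rfl))),
    prob_congr_support p (PDEvent ends a₁ a₂ a₃ ∩ (connEvent ends a₂ o ∩ connEvent ends a₂ b))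
      (PDEvent ends x a₂ a₃ ∩ (connEvent ends a₂ o ∩ connEvent ends a₂ b)) (fun ω hω => ((hPD ω hω).and (Iff.rfl.and Iff.rfl))),
    prob_congr_support p (PDEvent ends a₁ a₂ a₃ ∩ connEvent ends a₁ o)
      (PDEvent ends x a₂ a₃ ∩ connEvent ends x o) (fun ω hω => ((hPD ω hω).and (hc1 o ω hω))),
    prob_congr_support p (PDEvent ends a₁ a₂ a₃ ∩ connEvent ends a₂ o)
      (PDEvent ends x a₂ a₃ ∩ connEvent ends a₂ o) (fun ω hω => ((hPD ω hω).and Iff.rfl)),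
    prob_congr_support p (TEvent ends a₂ a₁ a₃ ∩ connEvent ends a₁ b)
      (TEvent ends a₂ x a₃ ∩ connEvent ends x b) (fun ω hω => ((hT' ω hω).and (hc1 b ω hω))),
    prob_congr_support p (TEvent ends a₁ a₂ a₃ ∩ connEvent ends a₂ b)
      (TEvent ends x a₂ a₃ ∩ connEvent ends a₂ b) (fun ω hω => ((hT ω hω).and Iff.rfl)),
    prob_congr_support p (TEvent ends a₁ a₂ a₃ ∩ connEvent ends a₁ b)
      (TEvent ends x a₂ a₃ ∩ connEvent ends x b) (fun ω hω => ((hT ω hω).and (hc1 b ω hω))),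
    prob_congr_support p (TEvent ends a₂ a₁ a₃ ∩ connEvent ends a₂ b)
      (TEvent ends a₂ x a₃ ∩ connEvent ends a₂ b) (fun ω hω => ((hT' ω hω).and Iff.rfl)),
    prob_congr_support p (TEvent ends a₂ a₁ a₃ ∩ (connEvent ends a₁ o ∩ connEvent ends a₁ b))
      (TEvent ends a₂ x a₃ ∩ (connEvent ends x o ∩ connEvent ends x b)) (fun ω hω => ((hT' ω hω).and ((hc1 o ω hω).and (hc1 b ω hω)))),
    prob_congr_support p (TEvent ends a₂ a₁ a₃ ∩ (connEvent ends a₂ o ∩ connEvent ends a₁ b))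
      (TEvent ends a₂ x a₃ ∩ (connEvent ends a₂ o ∩ connEvent ends x b)) (fun ω hω => ((hT' ω hω).and (Iff.rfl.and (hc1 b ω hω)))),
    prob_congr_support p (TEvent ends a₁ a₂ a₃ ∩ (connEvent ends a₁ o ∩ connEvent ends a₂ b))
      (TEvent ends x a₂ a₃ ∩ (connEvent ends x o ∩ connEvent ends a₂ b)) (fun ω hω => ((hT ω hω).and ((hc1 o ω hω).and Iff.rfl))),
    prob_congr_support p (TEvent ends a₁ a₂ a₃ ∩ (connEvent ends a₂ o ∩ connEvent ends a₂ b))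
      (TEvent ends x a₂ a₃ ∩ (connEvent ends a₂ o ∩ connEvent ends a₂ b)) (fun ω hω => ((hT ω hω).and (Iff.rfl.and Iff.rfl))),
    prob_congr_support p (TEvent ends a₁ a₂ a₃ ∩ (connEvent ends a₁ o ∩ connEvent ends a₁ b))
      (TEvent ends x a₂ a₃ ∩ (connEvent ends x o ∩ connEvent ends x b)) (fun ω hω => ((hT ω hω).and ((hc1 o ω hω).and (hc1 b ω hω)))),
    prob_congr_support p (TEvent ends a₁ a₂ a₃ ∩ (connEvent ends a₂ o ∩ connEvent ends a₁ b))
      (TEvent ends x a₂ a₃ ∩ (connEvent ends a₂ o ∩ connEvent ends x b)) (fun ω hω => ((hT ω hω).and (Iff.rfl.and (hc1 b ω hω)))),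
    prob_congr_support p (TEvent ends a₂ a₁ a₃ ∩ (connEvent ends a₁ o ∩ connEvent ends a₂ b))
      (TEvent ends a₂ x a₃ ∩ (connEvent ends x o ∩ connEvent ends a₂ b)) (fun ω hω => ((hT' ω hω).and ((hc1 o ω hω).and Iff.rfl))),
    prob_congr_support p (TEvent ends a₂ a₁ a₃ ∩ (connEvent ends a₂ o ∩ connEvent ends a₂ b))
      (TEvent ends a₂ x a₃ ∩ (connEvent ends a₂ o ∩ connEvent ends a₂ b)) (fun ω hω => ((hT' ω hω).and (Iff.rfl.and Iff.rfl))),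
    prob_congr_support p (TEvent ends a₂ a₁ a₃)
      (TEvent ends a₂ x a₃) (fun ω hω => (hT' ω hω)),
    prob_congr_support p (TEvent ends a₁ a₂ a₃)
      (TEvent ends x a₂ a₃) (fun ω hω => (hT ω hω)),
    prob_congr_support p (TEvent ends a₂ a₁ a₃ ∩ connEvent ends a₁ o)
      (TEvent ends a₂ x a₃ ∩ connEvent ends x o) (fun ω hω => ((hT' ω hω).and (hc1 o ω hω))),
    prob_congr_support p (TEvent ends a₂ a₁ a₃ ∩ connEvent ends a₂ o)
      (TEvent ends a₂ x a₃ ∩ connEvent ends a₂ o) (fun ω hω => ((hT' ω hω).and Iff.rfl)),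
    prob_congr_support p (TEvent ends a₁ a₂ a₃ ∩ connEvent ends a₁ o)
      (TEvent ends x a₂ a₃ ∩ connEvent ends x o) (fun ω hω => ((hT ω hω).and (hc1 o ω hω))),
    prob_congr_support p (TEvent ends a₁ a₂ a₃ ∩ connEvent ends a₂ o)
      (TEvent ends x a₂ a₃ ∩ connEvent ends a₂ o) (fun ω hω => ((hT ω hω).and Iff.rfl))]

omit [DecidableEq V] [LinearOrder R] [IsStrictOrderedRing R] in
/-- **Relabelling `a₃`**: if `a₃ ↔ x` on the support, `Gc` is unchanged when `a₃` is replaced by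
`x`. -/
theorem Gc_relabel_a3 (hx : ∀ ω, weight p ω ≠ 0 → Conn ends ω a₃ x) :
    Gc p ends o a₁ a₂ a₃ b = Gc p ends o a₁ a₂ x b := by
  have h3 := conn_left_iff p hx
  have h3' := conn_left_iff' p hx
  have hPD : ∀ ω, weight p ω ≠ 0 → (ω ∈ PDEvent ends a₁ a₂ a₃ ↔ ω ∈ PDEvent ends a₁ a₂ x) :=
    fun ω hω => by
      simp only [PDEvent, Dtilde, UnionCluster.inU, Set.mem_inter_iff, Set.mem_compl_iff,
        Set.mem_union, mem_connEvent, h3 ω hω]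
  have hT : ∀ ω, weight p ω ≠ 0 → (ω ∈ TEvent ends a₁ a₂ a₃ ↔ ω ∈ TEvent ends a₁ a₂ x) :=
    fun ω hω => by
      simp only [TEvent, Set.mem_inter_iff, Set.mem_compl_iff, mem_connEvent, h3' ω hω]
  have hT' : ∀ ω, weight p ω ≠ 0 → (ω ∈ TEvent ends a₂ a₁ a₃ ↔ ω ∈ TEvent ends a₂ a₁ x) :=
    fun ω hω => by
      simp only [TEvent, Set.mem_inter_iff, Set.mem_compl_iff, mem_connEvent, h3' ω hω]
  unfold Gc DEF EQbo EQb3 EQb3o EQo EQ3 EQ3o PDb PDbo Do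
  rw [
    prob_congr_support p (PDEvent ends a₁ a₂ a₃)
      (PDEvent ends a₁ a₂ x) (fun ω hω => (hPD ω hω)),
    prob_congr_support p (PDEvent ends a₁ a₂ a₃ ∩ connEvent ends a₁ b)
      (PDEvent ends a₁ a₂ x ∩ connEvent ends a₁ b) (fun ω hω => ((hPD ω hω).and Iff.rfl)),
    prob_congr_support p (PDEvent ends a₁ a₂ a₃ ∩ connEvent ends a₂ b)
      (PDEvent ends a₁ a₂ x ∩ connEvent ends a₂ b) (fun ω hω => ((hPD ω hω).and Iff.rfl)),
    prob_congr_support p (PDEvent ends a₁ a₂ a₃ ∩ (connEvent ends a₁ o ∩ connEvent ends a₁ b))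
      (PDEvent ends a₁ a₂ x ∩ (connEvent ends a₁ o ∩ connEvent ends a₁ b)) (fun ω hω => ((hPD ω hω).and (Iff.rfl.and Iff.rfl))),
    prob_congr_support p (PDEvent ends a₁ a₂ a₃ ∩ (connEvent ends a₂ o ∩ connEvent ends a₁ b))
      (PDEvent ends a₁ a₂ x ∩ (connEvent ends a₂ o ∩ connEvent ends a₁ b)) (fun ω hω => ((hPD ω hω).and (Iff.rfl.and Iff.rfl))),
    prob_congr_support p (PDEvent ends a₁ a₂ a₃ ∩ (connEvent ends a₁ o ∩ connEvent ends a₂ b))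
      (PDEvent ends a₁ a₂ x ∩ (connEvent ends a₁ o ∩ connEvent ends a₂ b)) (fun ω hω => ((hPD ω hω).and (Iff.rfl.and Iff.rfl))),
    prob_congr_support p (PDEvent ends a₁ a₂ a₃ ∩ (connEvent ends a₂ o ∩ connEvent ends a₂ b))
      (PDEvent ends a₁ a₂ x ∩ (connEvent ends a₂ o ∩ connEvent ends a₂ b)) (fun ω hω => ((hPD ω hω).and (Iff.rfl.and Iff.rfl))),
    prob_congr_support p (PDEvent ends a₁ a₂ a₃ ∩ connEvent ends a₁ o)
      (PDEvent ends a₁ a₂ x ∩ connEvent ends a₁ o) (fun ω hω => ((hPD ω hω).and Iff.rfl)),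
    prob_congr_support p (PDEvent ends a₁ a₂ a₃ ∩ connEvent ends a₂ o)
      (PDEvent ends a₁ a₂ x ∩ connEvent ends a₂ o) (fun ω hω => ((hPD ω hω).and Iff.rfl)),
    prob_congr_support p (TEvent ends a₂ a₁ a₃ ∩ connEvent ends a₁ b)
      (TEvent ends a₂ a₁ x ∩ connEvent ends a₁ b) (fun ω hω => ((hT' ω hω).and Iff.rfl)),
    prob_congr_support p (TEvent ends a₁ a₂ a₃ ∩ connEvent ends a₂ b)
      (TEvent ends a₁ a₂ x ∩ connEvent ends a₂ b) (fun ω hω => ((hT ω hω).and Iff.rfl)),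
    prob_congr_support p (TEvent ends a₁ a₂ a₃ ∩ connEvent ends a₁ b)
      (TEvent ends a₁ a₂ x ∩ connEvent ends a₁ b) (fun ω hω => ((hT ω hω).and Iff.rfl)),
    prob_congr_support p (TEvent ends a₂ a₁ a₃ ∩ connEvent ends a₂ b)
      (TEvent ends a₂ a₁ x ∩ connEvent ends a₂ b) (fun ω hω => ((hT' ω hω).and Iff.rfl)),
    prob_congr_support p (TEvent ends a₂ a₁ a₃ ∩ (connEvent ends a₁ o ∩ connEvent ends a₁ b))
      (TEvent ends a₂ a₁ x ∩ (connEvent ends a₁ o ∩ connEvent ends a₁ b)) (fun ω hω => ((hT' ω hω).and (Iff.rfl.and Iff.rfl))),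
    prob_congr_support p (TEvent ends a₂ a₁ a₃ ∩ (connEvent ends a₂ o ∩ connEvent ends a₁ b))
      (TEvent ends a₂ a₁ x ∩ (connEvent ends a₂ o ∩ connEvent ends a₁ b)) (fun ω hω => ((hT' ω hω).and (Iff.rfl.and Iff.rfl))),
    prob_congr_support p (TEvent ends a₁ a₂ a₃ ∩ (connEvent ends a₁ o ∩ connEvent ends a₂ b))
      (TEvent ends a₁ a₂ x ∩ (connEvent ends a₁ o ∩ connEvent ends a₂ b)) (fun ω hω => ((hT ω hω).and (Iff.rfl.and Iff.rfl))),
    prob_congr_support p (TEvent ends a₁ a₂ a₃ ∩ (connEvent ends a₂ o ∩ connEvent ends a₂ b))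
      (TEvent ends a₁ a₂ x ∩ (connEvent ends a₂ o ∩ connEvent ends a₂ b)) (fun ω hω => ((hT ω hω).and (Iff.rfl.and Iff.rfl))),
    prob_congr_support p (TEvent ends a₁ a₂ a₃ ∩ (connEvent ends a₁ o ∩ connEvent ends a₁ b))
      (TEvent ends a₁ a₂ x ∩ (connEvent ends a₁ o ∩ connEvent ends a₁ b)) (fun ω hω => ((hT ω hω).and (Iff.rfl.and Iff.rfl))),
    prob_congr_support p (TEvent ends a₁ a₂ a₃ ∩ (connEvent ends a₂ o ∩ connEvent ends a₁ b))
      (TEvent ends a₁ a₂ x ∩ (connEvent ends a₂ o ∩ connEvent ends a₁ b)) (fun ω hω => ((hT ω hω).and (Iff.rfl.and Iff.rfl))),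
    prob_congr_support p (TEvent ends a₂ a₁ a₃ ∩ (connEvent ends a₁ o ∩ connEvent ends a₂ b))
      (TEvent ends a₂ a₁ x ∩ (connEvent ends a₁ o ∩ connEvent ends a₂ b)) (fun ω hω => ((hT' ω hω).and (Iff.rfl.and Iff.rfl))),
    prob_congr_support p (TEvent ends a₂ a₁ a₃ ∩ (connEvent ends a₂ o ∩ connEvent ends a₂ b))
      (TEvent ends a₂ a₁ x ∩ (connEvent ends a₂ o ∩ connEvent ends a₂ b)) (fun ω hω => ((hT' ω hω).and (Iff.rfl.and Iff.rfl))),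
    prob_congr_support p (TEvent ends a₂ a₁ a₃)
      (TEvent ends a₂ a₁ x) (fun ω hω => (hT' ω hω)),
    prob_congr_support p (TEvent ends a₁ a₂ a₃)
      (TEvent ends a₁ a₂ x) (fun ω hω => (hT ω hω)),
    prob_congr_support p (TEvent ends a₂ a₁ a₃ ∩ connEvent ends a₁ o)
      (TEvent ends a₂ a₁ x ∩ connEvent ends a₁ o) (fun ω hω => ((hT' ω hω).and Iff.rfl)),
    prob_congr_support p (TEvent ends a₂ a₁ a₃ ∩ connEvent ends a₂ o)
      (TEvent ends a₂ a₁ x ∩ connEvent ends a₂ o) (fun ω hω => ((hT' ω hω).and Iff.rfl)),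
    prob_congr_support p (TEvent ends a₁ a₂ a₃ ∩ connEvent ends a₁ o)
      (TEvent ends a₁ a₂ x ∩ connEvent ends a₁ o) (fun ω hω => ((hT ω hω).and Iff.rfl)),
    prob_congr_support p (TEvent ends a₁ a₂ a₃ ∩ connEvent ends a₂ o)
      (TEvent ends a₁ a₂ x ∩ connEvent ends a₂ o) (fun ω hω => ((hT ω hω).and Iff.rfl))]

omit [DecidableEq V] [LinearOrder R] [IsStrictOrderedRing R] in
/-- `P(PD)` under the relabelling of `a₃`. -/
lemma prob_PD_relabel_a3 (hx : ∀ ω, weight p ω ≠ 0 → Conn ends ω a₃ x) :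
    prob p (PDEvent ends a₁ a₂ a₃) = prob p (PDEvent ends a₁ a₂ x) := by
  have h3 := conn_left_iff p hx
  exact prob_congr_support p _ _ fun ω hω => by
    simp only [PDEvent, Dtilde, UnionCluster.inU, Set.mem_inter_iff, Set.mem_compl_iff,
      Set.mem_union, mem_connEvent, h3 ω hω]

omit [DecidableEq V] [LinearOrder R] [IsStrictOrderedRing R] in
/-- `P(PD)` under the relabelling of `a₁`. -/
lemma prob_PD_relabel_a1 (hx : ∀ ω, weight p ω ≠ 0 → Conn ends ω a₁ x) :
    prob p (PDEvent ends a₁ a₂ a₃) = prob p (PDEvent ends x a₂ a₃) := by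
  have h1 := conn_left_iff p hx
  have h1' := conn_left_iff' p hx
  exact prob_congr_support p _ _ fun ω hω => by
    simp only [PDEvent, Dtilde, UnionCluster.inU, Set.mem_inter_iff, Set.mem_compl_iff,
      Set.mem_union, mem_connEvent, h1 ω hω, h1' ω hω]

omit [DecidableEq V] [LinearOrder R] [IsStrictOrderedRing R] in
/-- `P(Q)` under the relabelling of `a₁`. -/
lemma prob_Q_relabel_a1 (hx : ∀ ω, weight p ω ≠ 0 → Conn ends ω a₁ x) :
    prob p (avoidAll ends a₂ {a₁}) = prob p (avoidAll ends a₂ {x}) := by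
  have h1' := conn_left_iff' p hx
  exact prob_congr_support p _ _ fun ω hω => by
    simp only [mem_avoidAll, Finset.mem_singleton, forall_eq, h1' ω hω]

end Relabel

/-! ## Consequence: (MIX-CHORD) along every edge between the cluster of `a₃` and a root cluster -/

section Consequence

variable {V : Type*} {E : Type*} [Fintype E] [DecidableEq E] [Fintype V] [DecidableEq V]
  {R : Type*} [Field R] [LinearOrder R] [IsStrictOrderedRing R]

variable (p : E → R) (ends : E → Sym2 V) (o : V) {a₁ a₂ a₃ : V} (b : V) {e : E} {x y : V}

omit [Fintype V] [DecidableEq V] in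
/-- On the support of `p[e ↦ 0]` (`e` fractional) every weight-`1` edge of `p` is open. -/
lemma oneConfig_le_of_weight_update_zero_ne_zero (hfrac : e ∈ Chord.frac p) {ω : Config E}
    (hω : weight (Function.update p e 0) ω ≠ 0) : Chord.oneConfig p ≤ ω := by
  intro e'
  by_cases h : e' = e
  · subst h
    simp [Chord.oneConfig, (Chord.mem_frac.1 hfrac).2]
  · have := oneConfig_le_of_weight_ne_zero hω e'
    simpa [Chord.oneConfig, Function.update_of_ne h] using this

omit [Fintype V] [DecidableEq V] in
/-- The weight-`1` cluster of `v` is joined to `v` on the supports of `p`, `p[e ↦ 0]`, `p[e ↦ 1]`. -/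
lemma conn_oneCluster_three (hfrac : e ∈ Chord.frac p) {v z : V}
    (hz : z ∈ cluster ends (Chord.oneConfig p) v) :
    (∀ ω, weight p ω ≠ 0 → Conn ends ω v z) ∧
      (∀ ω, weight (Function.update p e 0) ω ≠ 0 → Conn ends ω v z) ∧
      (∀ ω, weight (Function.update p e 1) ω ≠ 0 → Conn ends ω v z) :=
  ⟨fun _ hω => conn_of_mem_oneCluster hω hz,
    fun _ hω => conn_mono (oneConfig_le_of_weight_update_zero_ne_zero p hfrac hω) (mem_cluster.1 hz),
    fun _ hω => conn_mono ((oneConfig_le_update_one p e).trans (oneConfig_le_of_weight_ne_zero hω))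
      (mem_cluster.1 hz)⟩

/-- **(MIX-CHORD) along every fractional edge from the weight-`1` cluster of `a₃` to the weight-`1`
cluster of `a₁`**: relabel `a₃ ↦ x`, `a₁ ↦ y` and use g18's root-edge chord theorem. -/
theorem mixChord_a3Cluster_rootCluster (hp : IsProbVec p) (hfrac : e ∈ Chord.frac p)
    (hx : x ∈ cluster ends (Chord.oneConfig p) a₃) (hy : y ∈ cluster ends (Chord.oneConfig p) a₁)
    (he : ends e = s(x, y)) :
    p e * Gc (Function.update p e 1) ends o a₁ a₂ a₃ b +
      (1 - p e) * (shrink p ends a₁ a₂ a₃ e * Gc (Function.update p e 0) ends o a₁ a₂ a₃ b) ≤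
        Gc p ends o a₁ a₂ a₃ b := by
  obtain ⟨s3, s3₀, s3₁⟩ := conn_oneCluster_three p ends hfrac hx
  obtain ⟨s1, s1₀, s1₁⟩ := conn_oneCluster_three p ends hfrac hy
  have h := mixChord_root_edge p ends o (a₁ := y) (a₂ := a₂) (a₃ := x) b hp he
  rw [Gc_relabel_a3 p ends o b s3, Gc_relabel_a1 p ends o b s1,
    Gc_relabel_a3 _ ends o b s3₀, Gc_relabel_a1 _ ends o b s1₀,
    Gc_relabel_a3 _ ends o b s3₁, Gc_relabel_a1 _ ends o b s1₁]
  have hsh : shrink p ends a₁ a₂ a₃ e = shrink p ends y a₂ x e := by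
    unfold shrink
    rw [prob_PD_relabel_a3 p ends s3, prob_PD_relabel_a1 p ends s1, prob_Q_relabel_a1 p ends s1,
      prob_PD_relabel_a3 _ ends s3₀, prob_PD_relabel_a1 _ ends s1₀, prob_Q_relabel_a1 _ ends s1₀]
  rw [hsh]
  exact h

/-- The `a₂`-side version: an edge from the cluster of `a₃` to the cluster of `a₂`. -/
theorem mixChord_a3Cluster_rootCluster₂ (hp : IsProbVec p) (hfrac : e ∈ Chord.frac p)
    (hx : x ∈ cluster ends (Chord.oneConfig p) a₃) (hy : y ∈ cluster ends (Chord.oneConfig p) a₂)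
    (he : ends e = s(x, y)) :
    p e * Gc (Function.update p e 1) ends o a₁ a₂ a₃ b +
      (1 - p e) * (shrink p ends a₁ a₂ a₃ e * Gc (Function.update p e 0) ends o a₁ a₂ a₃ b) ≤
        Gc p ends o a₁ a₂ a₃ b := by
  have h := mixChord_a3Cluster_rootCluster p ends o (a₁ := a₂) (a₂ := a₁) b hp hfrac hx hy he
  rw [shrink_root_swap, CovForm.Gc_swap p, CovForm.Gc_swap (Function.update p e 1),
    CovForm.Gc_swap (Function.update p e 0)] at h
  exact h

end Consequence

end Mix

end Summit.Ventures.PercRepro2
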